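import Mathlib
import HarnessLib
import Summits.NavierStokesRegularity.NavierStokesRegularity.Theorems.LocalHelicityTubeDoorFrobeniusWindowRigidityWindow
import Summits.NavierStokesRegularity.NavierStokesRegularity.Theorems.IsobarTomographyTubeAlternativeStubDefectAnalyticOfVelocity

/-!
# Door S11 `LocalTubeDoorHelicity` (nsreg-p1 ROUND-11), profile crux K2⁗ — the helicity density of a Type-I profile is
# JOINTLY real-analytic on the backward slab; SPACE–TIME window ⇒ slab

Cell ns-regularity-ideate, seat p6 (route-directed support for an UNSTAGED door; anchor
`--supports stmt-NavierStokesRegularity-20018`; edge re-pointed at birth).  Complements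
`…FrobeniusWindowRigidityWindow.helicityWindowToSlab` (a spatial window at EVERY slice ⇒ slab):

* `analyticOnNhd_helicity_uncurry` — for a profile of the Type-I class the helicity density
  `(s, y) ↦ ⟪v s y, curl (v s) y⟫` is jointly real-analytic on `(−∞,0) × ℝ³` (joint analyticity of Oseen-ancient fields
  `…Ancient.analyticOnNhd_uncurry`, of their vorticity `…AnalyticPropagation.analyticOnNhd_uncurry_curl`, and of inner
  products);
* `helicityFree_of_spacetimeWindow` — hence vanishing of the helicity density on ANY nonempty open subset of the backward
  slab (a small space–time box suffices) forces `v · curl v ≡ 0` on the whole slab (identity theorem on the convex slab):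
  the Frobenius class `𝔉` is «rigid in space–time»;
* `frobeniusSpacetimeWindowRigidity_of_profileRigidity` — consequently K2⁗'s profile form `FrobeniusProfileRigidity`
  already excludes backward singularity for every profile whose helicity density vanishes on SOME space–time open set.

WHAT THIS IS NOT: not a claim about Navier–Stokes regularity and not K2⁗ — analytic-continuation bookkeeping for a door
route that is not yet staged (bears_on LADDER-NS N0).
-/

noncomputable section

-- the summit and its single sub-problem share the name (CONVENTIONS §1), as in every Theorems file
set_option linter.dupNamespace false

namespace Summit.NavierStokesRegularity.NavierStokesRegularity.Theorems.LocalHelicityTubeDoorFrobeniusWindowRigiditySpacetime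

open MeasureTheory Set Function Filter Topology TopologicalSpace Metric
open scoped RealInnerProductSpace InnerProductSpace
open Literature.Analysis Literature.Analysis.FluidPDE
open Summit.NavierStokesRegularity.NavierStokesRegularity.Theorems.LocalSineTubeDoorProfileAlignedWindowRigidityAncient
open Summit.NavierStokesRegularity.NavierStokesRegularity.Theorems.TubeAlternative.AnalyticPropagation

/-- **The helicity density of a profile of the Type-I class is jointly real-analytic** on the backward slab
`(−∞,0) × ℝ³`. -/
theorem analyticOnNhd_helicity_uncurry {C : ℝ} {v : ℝ → EuclideanSpace ℝ (Fin 3) → EuclideanSpace ℝ (Fin 3)}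
    (hrate : HasTypeITimeDecay C v) (hcont : ContinuousOn (uncurry v) (Iio (0 : ℝ) ×ˢ univ))
    (hmild : ∀ s t : ℝ, s < t → t < 0 → ∀ x,
      v t x = UnboundedOperators.heatExtension (v s) (t - s) x - oseenDuhamel 1 s v v t x) :
    AnalyticOnNhd ℝ (uncurry fun s y => ⟪v s y, curl (v s) y⟫_ℝ) (Iio (0 : ℝ) ×ˢ univ) := by
  have hv : AnalyticOnNhd ℝ (uncurry v) (Iio (0 : ℝ) ×ˢ univ) :=
    analyticOnNhd_uncurry hcont (bdd_of_hasTypeITimeDecay hrate) hmild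
  have hcurl := analyticOnNhd_uncurry_curl hv isOpen_Iio
  intro z hz
  exact analyticAt_inner_of_analyticAt (hv z hz) (hcurl z hz)

/-- **Space–time window ⇒ slab.**  If the helicity density of a profile of the Type-I class vanishes on a nonempty open
subset `W` of the backward slab `(−∞,0) × ℝ³`, it vanishes identically on the slab. -/
theorem helicityFree_of_spacetimeWindow {C : ℝ} {v : ℝ → EuclideanSpace ℝ (Fin 3) → EuclideanSpace ℝ (Fin 3)}
    (hrate : HasTypeITimeDecay C v) (hcont : ContinuousOn (uncurry v) (Iio (0 : ℝ) ×ˢ univ))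
    (hmild : ∀ s t : ℝ, s < t → t < 0 → ∀ x,
      v t x = UnboundedOperators.heatExtension (v s) (t - s) x - oseenDuhamel 1 s v v t x)
    {W : Set (ℝ × EuclideanSpace ℝ (Fin 3))} (hW : IsOpen W) (hne : W.Nonempty) (hWslab : W ⊆ Iio (0 : ℝ) ×ˢ univ)
    (h : ∀ z ∈ W, ⟪v z.1 z.2, curl (v z.1) z.2⟫_ℝ = 0) :
    ∀ s < 0, ∀ y : EuclideanSpace ℝ (Fin 3), ⟪v s y, curl (v s) y⟫_ℝ = 0 := by
  have han := analyticOnNhd_helicity_uncurry hrate hcont hmild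
  obtain ⟨z₀, hz₀⟩ := hne
  have hev : (uncurry fun s y => ⟪v s y, curl (v s) y⟫_ℝ) =ᶠ[𝓝 z₀] 0 :=
    Filter.eventually_of_mem (hW.mem_nhds hz₀) fun z hz => h z hz
  have hpre : IsPreconnected (Iio (0 : ℝ) ×ˢ (univ : Set (EuclideanSpace ℝ (Fin 3)))) :=
    ((convex_Iio (0 : ℝ)).prod convex_univ).isPreconnected
  intro s hs y
  have := han.eqOn_zero_of_preconnected_of_eventuallyEq_zero hpre (hWslab hz₀) hev
    (mk_mem_prod (mem_Iio.2 hs) (mem_univ y))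
  simpa using this

/-- **K2⁗ in space–time window form ⇐ profile form**: if every profile of the Type-I class with `v · curl v ≡ 0` on
the slab is not backward-singular at the apex (`FrobeniusProfileRigidity`), then already every such profile whose helicity
density vanishes on SOME nonempty open subset of the backward slab is not backward-singular. -/
theorem frobeniusSpacetimeWindowRigidity_of_profileRigidity
    (hprofile : ∀ (C : ℝ) (v : ℝ → EuclideanSpace ℝ (Fin 3) → EuclideanSpace ℝ (Fin 3)),
      Literature.Analysis.FluidPDE.HasTypeITimeDecay C v →
      ContinuousOn (Function.uncurry v) (Set.Iio (0 : ℝ) ×ˢ Set.univ) →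
      (∀ s t : ℝ, s < t → t < 0 → ∀ x, v t x =
        Literature.Analysis.UnboundedOperators.heatExtension (v s) (t - s) x -
          Literature.Analysis.FluidPDE.oseenDuhamel 1 s v v t x) →
      (∀ t < 0, Literature.Analysis.FluidPDE.VectorCalculus.IsDivFree (v t)) →
      (∀ s < 0, ∀ y : EuclideanSpace ℝ (Fin 3), ⟪v s y, Literature.Analysis.FluidPDE.curl (v s) y⟫_ℝ = 0) →
      ¬ Literature.Analysis.FluidPDE.IsBackwardSingularPoint v 0) :
    ∀ (C : ℝ) (v : ℝ → EuclideanSpace ℝ (Fin 3) → EuclideanSpace ℝ (Fin 3)),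
    Literature.Analysis.FluidPDE.HasTypeITimeDecay C v →
    ContinuousOn (Function.uncurry v) (Set.Iio (0 : ℝ) ×ˢ Set.univ) →
    (∀ s t : ℝ, s < t → t < 0 → ∀ x, v t x =
      Literature.Analysis.UnboundedOperators.heatExtension (v s) (t - s) x -
        Literature.Analysis.FluidPDE.oseenDuhamel 1 s v v t x) →
    (∀ t < 0, Literature.Analysis.FluidPDE.VectorCalculus.IsDivFree (v t)) →
    (∃ W : Set (ℝ × EuclideanSpace ℝ (Fin 3)), IsOpen W ∧ W.Nonempty ∧ W ⊆ Set.Iio (0 : ℝ) ×ˢ Set.univ ∧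
      ∀ z ∈ W, ⟪v z.1 z.2, Literature.Analysis.FluidPDE.curl (v z.1) z.2⟫_ℝ = 0) →
    ¬ Literature.Analysis.FluidPDE.IsBackwardSingularPoint v 0 := by
  intro C v hrate hcont hmild hdiv hW
  obtain ⟨W, hWo, hne, hWslab, h⟩ := hW
  exact hprofile C v hrate hcont hmild hdiv (helicityFree_of_spacetimeWindow hrate hcont hmild hWo hne hWslab h)

end Summit.NavierStokesRegularity.NavierStokesRegularity.Theorems.LocalHelicityTubeDoorFrobeniusWindowRigiditySpacetime

end
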